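import Summits.QuantumFields.YangMills.Theorems.BalabanUVNodesN14AtRecord
import Literature.MathematicalPhysics.QuantumFieldTheory.Balaban1983to89.Node00.Record11CarriersB8

/-!
# DAG node N14 · NE1′ — THE K4 STUB `YMDAG.UVSplit.S_N14 RRec` READ AT NODE 00's STAGE-11 RECORD OF RECORD (`Node00/Record11`,
# `Record11Carriers`, `Record11CarriersB8`, 2026-08-26): a RECORD CENSUS in cluster K4's own vocabulary — (§1) the generic regression test every
# rate-record home must pass (a home blind to `R.ne1` is REFUTED as soon as it admits one bundle); (§2) keyed to a record predicate ALONE the stub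
# IS the emptiness of the record class, hence FALSE at ₁₁C ∕ ₁₁CB10YZW ∕ ₁₁CB10YZWB8 given inhabitation, and FALSE at `N = 2` under the route's K0
# `Record11Inhabited`; (§3) the ₁₁ homes «record key ∧ clause» that DO close it — by ONE application of n14-a's `s_N14_of_uniformLeaves` ∕
# `s_N14_of_refines` — and the kernel fact that the slot-keyed one closes K4's existence stub `S_R00x` TOO, by the toy bundle: junk end to end;
# (§4) the sibling rates N15 ∕ N16 ∕ N18 ∕ N22 do not give N14 at the carriers (FAN-OUT §N14 s3 verdict)

Cell `pub-ymgap`, YM-PLAN Track A (HUMAN RULING D-0062), R134 acceleration seat `pub-ymgap-dag-n14-d` (strategy s2: «knit `s_N14_of_uniformLeaves` ∕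
`_of_refines` at `RRec` ₁₁, or flag `not_s_N14_of_admits`»), generation 0.  Pattern: n07-a's ∕ n10-a's `BalabanUVNodesN07RecordCensus` ∕
`BalabanUVNodesN10RecordCensus` (the same census for the K2∕K3 stubs `S_N07` ∕ `S_N10` at ₅C … ₉C).  THEOREMS ONLY (0 `def`, 0 `sorry`, standard axioms);
imports n14-a's closer of record `BalabanUVNodesN14AtRecord` (p419066; through it the K4 module `BalabanUVNodesSpineRates`, modules 1∕4∕5 and the NE1′
owner lineage's `Spine/NE1p/DressedRootStrict` ∕ `DressedRootWitness`) and NODE 00's `Record11CarriersB8` (through it `Record11Carriers`, `Record11`);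
modifies nothing; every cited lemma is used BY NAME.  `--supports stmt-QuantumFields-19676` (K3 `SpineGivenEndpointR11`).

THE QUESTION OF THE ROW.  K3 at rev 1 reads `∀ F D w, Node00.IsRecordOfRecord₁₁C F 2 D w → (B) → END → HybridNE7Under D END`, i.e. the cluster statement
`YMDAG.UVSplit.Spine Rec₁₁` guarded by (B) and END, reached by `B5_at_record` from `SpineRates Rec₁₁ (RateInputs RRec)` (`SpineRates_of Rec₁₁ RRec` — seven
binders `S_R00x Rec₁₁ RRec`, `S_N14 RRec`, …, `S_N22 RRec`) for ANY rate-record predicate `RRec : RateRecordPred N` of the prover's choosing.  The K4 stub of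
this node, `S_N14 RRec := ∀ F D g₀ os R, RRec F D g₀ os R → N14At R.ne1` (`N14At c := DressedStabilityStrict c.𝒯 c.Λ`, the R424 re-home of the record decl
`…NE1p.DressedRoot.DressedStabilityStrict 𝒯 Λ`), is therefore as strong as `RRec`'s PIN on the NE1′ carriers `R.ne1 = ⟨P, 𝒯, Λ⟩`.  At which `RRec` keyed to
the Stage-11 record is it a TRUE statement, and where does N14's content then sit?

WHAT IS PROVED.
* §1 **`not_s_N14_of_ne1SwapClosed`** — THE GENERIC REGRESSION TEST (any stage, any home): a rate-record predicate CLOSED UNDER SWAPPING `R.ne1` (it does not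
  read the NE1′ carriers) and admitting ONE bundle makes `S_N14` FALSE (swap in the owner's doubling tower at its own count rate, `not_n14At_growing_one`).
  A home keyed on `R.u3` (what N18 ∕ N22 want first) or on `R.ne3` alone is such a predicate: `S_N14` must not be `--split` over it.
* §2 **`s_N14_recordKey_iff_empty`** — KEYED TO A RECORD PREDICATE ALONE, `RRec := fun F D _ _ _ => ∃ w, Rec F D w` (blind to `g₀`, `os` AND `R` — the only
  keys writable from `Node00/Record11*` today: `Stage11Params` carries 0 rate-carrier fields, n18-a census 10:01Z), `S_N14` IS `∀ F D w, ¬ Rec F D w` (`Iff`):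
  the stub says nothing but «the record class is empty».  Hence **`not_s_N14_record₁₁C ∕ ₁₁CB10YZW ∕ ₁₁CB10YZWB8`** (FALSE given inhabitation of the
  respective Stage-11 class — whatever ELSE is pinned) and **`not_s_N14_record₁₁C_two`**: under the route's K0 `Record11Inhabited` (its text verbatim as the
  hypothesis) the record-keyed stub at the group of record `SU(2)` is FALSE — K0 and a record-ALONE-keyed `S_N14` are jointly inconsistent.
* §3 THE HOMES THAT CLOSE IT, AND THE JUNK TEST.  For a clause `Φ : RateRecordPred N`, the ₁₁ home «record key ∧ Φ»: **`s_N14_record₁₁_and_iff`** (what it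
  says: at every Stage-11 record, every bundle with `Φ` has N14 — `Iff`); **`s_N14_record₁₁_of_slotClause`** — if `Φ` carries the slot «∃ U : UniformConstants,
  U.Λ = R.ne1.Λ ∧ ∀ p K, Nonempty (BookingLeaves U (R.ne1.𝒯.B p K) (R.ne1.𝒯.T p K))» then `S_N14` HOLDS (ONE application of `s_N14_of_uniformLeaves` — END-B
  by name: THE KNIT OF THE ROW at the only ₁₁ homes typable today), **`s_N14_of_refines_record₁₁_slot`** (every refinement of «key ∧ slot» closes, ONE application
  of `s_N14_of_refines`).  THE JUNK TEST **`slotKey₁₁_closes_R00x_and_N14`**: at the slot-keyed home `Φ := slot` BOTH K4's existence stub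
  `S_R00x Rec₁₁ (key ∧ slot)` AND `S_N14 (key ∧ slot)` hold — by the owner's TOY bundle `⟨Unit, toyTower, 2⟩` (`uniformLeaves_inhabited`), for trivial
  thresholds (`ForSmallCouplings.of_forall`): the pair carries NO content about Bałaban's run.  R422 DEFINITION FIRST for K4's N14, in the kernel: a
  content-bearing home must pin `R.ne1.𝒯` to the dressed tower OF RECORD — an OBJECT built from the record's `θ`, `g₀`, `os` (the observable-attached
  effective densities' bookings; NODE O ∕ a definer module), not a clause about `R.ne1` alone; until it exists N14's content sits nowhere in K4.
  **`n14Key₁₁_closes_R00x_and_N14`**: the same junk closes the tautological home «key ∧ N14At R.ne1».  **`s_N14_iff_of_pinned`** — THE OBJECT-KEYED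
  SHAPE (dual of §1's test): a home PINNING `R.ne1` to an object `ne1Of F D g₀ os` makes `S_N14` exactly «NE1′ for that object at every admitted datum» (`Iff`).
* §4 **`exists_siblings_not_n14At`** ∕ **`not_n14At_of_siblings`** — FAN-OUT v1.1 §N14 s3 («NE5 ∧ NE3 ∧ … ⇒ NE1′ as one theorem at the spine carriers»)
  VERDICT: there is NO carrier-level arrow — a bundle `R : RateCarriers N` with `N15At R.ne2`, `N16At R.ne3`, `N18At R.u3`, `N22At R.u3` and `¬ N14At R.ne1`
  (DEGENERATE sibling carriers: empty index ∕ domain ∕ window, zero moduli; the doubling tower at `ne1`).  The four sub-bundles are independent coordinates;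
  any «siblings ⇒ NE1′» theorem needs an identification datum linking `R.u3`'s domains to `R.ne1`'s births (n14-a's binders (ℓ1)–(ℓ3′), consumer-side only)
  AND an estimate on single-run dressed sizes that NE5 (two-run functional matching) and NE3 (minimiser rates) do not state — the s1 DRESSING estimate.

* §5 (v1.1, APPEND-ONLY) THE θ-KEYED STAGE-PATTERN HOME «`R = rc θ hP ℓ g₀ os`» (the design in flight at `node00-def-RR-1∕-RR-2`, PRE-READ-RR-2 §B):
  N14's faces GENERIC in the carrier description — **`s_N14_paramKey_iff`** (any description `Pc θ hP g₀ os R`), **`s_N14_thetaKey_iff`** (`S_N14` = NE1′ at `(rc …).ne1` for every admissible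
  parameter: the stub IS the dressing estimate for the object), **`s_N14_thetaKey_of_n14At`** ∕ **`_of_uniformLeaves`** (THE KNIT, one `exact`),
  **`s_R00x_thetaKey`** (K4's existence stub closes by the home itself for ANY `rc` with inhabited binders — nothing of N14 sits in `S_R00x`),
  **`not_s_N14_thetaKey_of_hits_growing`** (§1's test at the home: a carrier map whose `ne1` takes the doubling-tower value — e.g. a FREE binder —
  refutes `S_N14`), **`finalProfile_at_thetaKey`** (N19's consumer shape at the object of record).

HONEST FRAMING.  Count-neutral kernel bookkeeping over the route's K4 stub and NODE 00's Stage-11 predicates; N14 NOT discharged (typed 28∕28 · discharged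
5∕28 unmoved); NE1′ is NOT PRINTED ([Balaban1989LargeFieldII] (1.73)–(1.75) pp. 379–380 type the action only) and NOT PROVED; nothing of Bałaban's is
asserted or denied at his objects — the refuting ∕ inhabiting bundles are DEGENERATE probes of the typing (toy and doubling towers, empty carriers); no
`RRec` home pinning `R.ne1` to an object exists in the tree (2026-08-26).  One finite four-torus programme at fixed `ε` — NOT infinite volume, NOT OS on
ℝ⁴, NOT a mass gap, NOT Clay.
-/

noncomputable section

namespace YMDAG.N14

open Literature.MathematicalPhysics.QuantumFieldTheory.Balaban1983to89
open Literature.MathematicalPhysics.QuantumFieldTheory.Balaban1983to89.T4Continuum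
open Literature.MathematicalPhysics.QuantumFieldTheory.Balaban1983to89.T4OutputRate (NE5 NE9 FadingMemory)
open Summit.QuantumFields.BalabanUV.T4Continuum.NE1p.DressedRoot
open YMDAG.UVSplit

variable {N : ℕ} [NeZero N]

/-! ## §1 The generic regression test: a home blind to `R.ne1` is refuted by one admitted bundle -/

/-- **A RATE-RECORD PREDICATE CLOSED UNDER SWAPPING THE NE1′ CARRIERS AND ADMITTING ONE BUNDLE HAS NO `S_N14`** [bookkeeping]: swap `R.ne1` for the
owner's doubling tower at its own count rate `⟨Unit, growingTower, 1⟩` (`not_n14At_growing_one`) and apply n14-a's `not_s_N14_of_admits`.  Every later-stage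
home that pins `R.u3` ∕ `R.ne3` ∕ `R.ne2` but leaves `R.ne1` residual is such a predicate. [folklore] -/
theorem not_s_N14_of_ne1SwapClosed (RRec : RateRecordPred N)
    (hsw : ∀ (F : T4Family) (D : Datum F N) (g₀ : ℕ → ℝ) (os : List (ULoop F)) (R : RateCarriers N) (c : NE1pCarriers),
      RRec F D g₀ os R → RRec F D g₀ os { R with ne1 := c })
    (hex : ∃ (F : T4Family) (D : Datum F N) (g₀ : ℕ → ℝ) (os : List (ULoop F)) (R : RateCarriers N), RRec F D g₀ os R) :
    ¬ S_N14 RRec := by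
  obtain ⟨F, D, g₀, os, R, hR⟩ := hex
  exact not_s_N14_of_admits RRec
    ⟨F, D, g₀, os, { R with ne1 := ⟨Unit, growingTower, 1⟩ }, hsw F D g₀ os R _ hR, not_n14At_growing_one⟩

/-- The same test, pointed: a predicate admitting, next to some bundle, the bundle with `ne1` swapped for the doubling tower at rate `1` has no `S_N14`.
[folklore] -/
theorem not_s_N14_of_admits_growing (RRec : RateRecordPred N)
    (hex : ∃ (F : T4Family) (D : Datum F N) (g₀ : ℕ → ℝ) (os : List (ULoop F)) (R : RateCarriers N),
      RRec F D g₀ os { R with ne1 := ⟨Unit, growingTower, 1⟩ }) :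
    ¬ S_N14 RRec := by
  obtain ⟨F, D, g₀, os, R, hR⟩ := hex
  exact not_s_N14_of_admits RRec ⟨F, D, g₀, os, _, hR, not_n14At_growing_one⟩

/-! ## §2 Keyed to a record predicate ALONE the stub is the emptiness of the record class; the Stage-11 instances; K0 -/

/-- **KEYED TO A RECORD PREDICATE ALONE, `S_N14` IS THE EMPTINESS OF THE RECORD CLASS** [bookkeeping]: for every `Rec : RecordPred N`, at the key
`fun F D _ _ _ => ∃ w, Rec F D w` (blind to the tuned sequence, the loop string AND the rate carriers) the stub holds iff NO `(F, D, w)` is a record — «→»: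
a record would admit the doubling-tower bundle; «←»: vacuity (`s_N14_of_empty`). [folklore] -/
theorem s_N14_recordKey_iff_empty (Rec : RecordPred N) :
    S_N14 (fun F D _ _ _ => ∃ w : DagBinding.WorldP, Rec F D w) ↔
      ∀ (F : T4Family) (D : Datum F N) (w : DagBinding.WorldP), ¬ Rec F D w := by
  constructor
  · intro h F D w hR
    -- a bundle with the doubling tower at `ne1` and degenerate sibling carriers
    let R₀ : RateCarriers N :=
      { ne1 := ⟨Unit, growingTower, 1⟩
        ne2 := { I := PEmpty, c35 := 0, p := 0, pi := fun i => i.elim, Kop := fun i => i.elim, Ksite := fun i => i.elim,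
                 Kunit := fun i => i.elim, inΛ := fun i => i.elim, unitDist := fun i => i.elim }
        ne3 := ⟨1, 1, 1, 0, 0, 0, 0, 0, ∅⟩
        u3 := { C := ⟨Unit, fun _ => 1, fun _ => 0, fun _ => le_rfl, Unit, Unit, fun _ _ => 0, fun _ _ => le_rfl, id⟩,
                W := ∅, γ := 0, κ := 0, EA := fun _ _ _ => 0, EB := fun _ _ _ _ => 0, θ := 0, C₅ := 0,
                Λ := fun _ _ => 0, C₉ := 0, ω := 0, cr := 0, ρ := 0 } }
    exact not_n14At_growing_one (h F D (fun _ => 0) [] R₀ ⟨w, hR⟩)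
  · intro h
    exact s_N14_of_empty _ fun F D _ _ _ ⟨w, hR⟩ => h F D w hR

/-- Hence: a record predicate INHABITED on some family makes the record-keyed stub FALSE. [folklore] -/
theorem not_s_N14_recordKey_of_inhabited (Rec : RecordPred N)
    (hex : ∃ (F : T4Family) (D : Datum F N) (w : DagBinding.WorldP), Rec F D w) :
    ¬ S_N14 (fun F D _ _ _ => ∃ w : DagBinding.WorldP, Rec F D w) := by
  rw [s_N14_recordKey_iff_empty]
  obtain ⟨F, D, w, hR⟩ := hex
  exact fun h => h F D w hR

/-- **`S_N14` KEYED TO THE STAGE-11 RECORD OF RECORD `Node00.IsRecordOfRecord₁₁C` ALONE IS FALSE as soon as the Stage-11 class is inhabited on some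
family** (inhabitation at `N = 2` is the route's K0 `Record11Inhabited`, stmt-QuantumFields-19673). [folklore] -/
theorem not_s_N14_record₁₁C
    (hex : ∃ (F : T4Family) (D : Datum F N) (w : DagBinding.WorldP), Node00.IsRecordOfRecord₁₁C F N D w) :
    ¬ S_N14 (fun F D _ _ _ => ∃ w : DagBinding.WorldP, Node00.IsRecordOfRecord₁₁C F N D w) :=
  not_s_N14_recordKey_of_inhabited _ hex

/-- … the same at the four-pin Stage-11 record `IsRecordOfRecord₁₁CB10YZW` ([B10] ∕ Y ∕ Z ∕ W groups pinned — whatever ELSE is pinned, a key that does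
not read `R.ne1` fails the §1 test). [folklore] -/
theorem not_s_N14_record₁₁CB10YZW
    (hex : ∃ (F : T4Family) (D : Datum F N) (w : DagBinding.WorldP), Node00.IsRecordOfRecord₁₁CB10YZW F N D w) :
    ¬ S_N14 (fun F D _ _ _ => ∃ w : DagBinding.WorldP, Node00.IsRecordOfRecord₁₁CB10YZW F N D w) :=
  not_s_N14_recordKey_of_inhabited _ hex

/-- … and at the five-pin Stage-11 record `IsRecordOfRecord₁₁CB10YZWB8` ([B8] innermost). [folklore] -/
theorem not_s_N14_record₁₁CB10YZWB8
    (hex : ∃ (F : T4Family) (D : Datum F N) (w : DagBinding.WorldP), Node00.IsRecordOfRecord₁₁CB10YZWB8 F N D w) :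
    ¬ S_N14 (fun F D _ _ _ => ∃ w : DagBinding.WorldP, Node00.IsRecordOfRecord₁₁CB10YZWB8 F N D w) :=
  not_s_N14_recordKey_of_inhabited _ hex

/-- Inhabitation of the five-pin class gives that of `₁₁C` with THE SAME datum (NODE 00's companion ∕ refinement BY NAME: `companion_of_isRecordOfRecord₁₁CB10YZWB8`,
`isRecordOfRecord₁₁C_of_isRecordOfRecord₁₁CB10YZW`), so ONE inhabitant of
`IsRecordOfRecord₁₁CB10YZWB8` refutes all three record-keyed stubs. [folklore] -/
theorem not_s_N14_record₁₁C_of_B8inhabited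
    (hex : ∃ (F : T4Family) (D : Datum F N) (w : DagBinding.WorldP), Node00.IsRecordOfRecord₁₁CB10YZWB8 F N D w) :
    ¬ S_N14 (fun F D _ _ _ => ∃ w : DagBinding.WorldP, Node00.IsRecordOfRecord₁₁C F N D w) := by
  obtain ⟨F, D, w, h⟩ := hex
  obtain ⟨w', h4, -⟩ := Node00.companion_of_isRecordOfRecord₁₁CB10YZWB8 h
  exact not_s_N14_record₁₁C ⟨F, D, w', Node00.isRecordOfRecord₁₁C_of_isRecordOfRecord₁₁CB10YZW h4⟩

/-- **UNDER THE ROUTE's K0, THE RECORD-KEYED STUB AT THE GROUP OF RECORD IS FALSE** [bookkeeping]: the hypothesis is the text of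
`Summit.QuantumFields.YangMills.Theses.BalabanUVNodes.Record11Inhabited` (stmt-QuantumFields-19673) verbatim; instantiate it at the family `L = 13, m = 1`.
K0 and a record-ALONE-keyed `S_N14` are jointly inconsistent — the K4 child `S_N14` waits for a home PINNING `R.ne1`. [folklore] -/
theorem not_s_N14_record₁₁C_two
    (h0 : ∀ F : T4Family, ∃ (D : FiniteEpsData F (Matrix.specialUnitaryGroup (Fin 2) ℂ)) (w : DagBinding.WorldP),
      Node00.IsRecordOfRecord₁₁C F 2 D w) :
    ¬ S_N14 (N := 2) (fun F D _ _ _ => ∃ w : DagBinding.WorldP, Node00.IsRecordOfRecord₁₁C F 2 D w) := by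
  obtain ⟨D, w, hR⟩ := h0 ⟨13, ⟨⟨6, rfl⟩, by norm_num⟩, by norm_num, 1, le_rfl⟩
  exact not_s_N14_record₁₁C ⟨_, D, w, hR⟩

/-! ## §3 The Stage-11 homes «record key ∧ clause» that close the stub, and the junk test -/

section Homes

variable (Φ : RateRecordPred N)

/-- **WHAT `S_N14` SAYS AT THE HOME «STAGE-11 RECORD KEY ∧ CLAUSE Φ»** (`Iff`, currying): at every Stage-11 record, every rate-carrier bundle with `Φ` has
N14 at its NE1′ carriers. [folklore] -/
theorem s_N14_record₁₁_and_iff :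
    S_N14 (fun F D g₀ os R => (∃ w : DagBinding.WorldP, Node00.IsRecordOfRecord₁₁C F N D w) ∧ Φ F D g₀ os R) ↔
      ∀ (F : T4Family) (D : Datum F N) (g₀ : ℕ → ℝ) (os : List (ULoop F)) (R : RateCarriers N),
        (∃ w : DagBinding.WorldP, Node00.IsRecordOfRecord₁₁C F N D w) → Φ F D g₀ os R → N14At R.ne1 :=
  ⟨fun h F D g₀ os R hw hΦ => h F D g₀ os R ⟨hw, hΦ⟩, fun h F D g₀ os R hR => h F D g₀ os R hR.1 hR.2⟩

/-- **THE KNIT OF THE ROW — `S_N14` AT EVERY STAGE-11 HOME WHOSE CLAUSE CARRIES THE SLOT** [bookkeeping]: ONE application of n14-a's refinement-generic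
closer `s_N14_of_uniformLeaves` (END-B `dressedStabilityStrict_of_bookingLeaves` BY NAME).  The slot's content — the wall (w1)…(w7) = the ten fields of
`BookingLeaves` on Bałaban's dressed run — is what the clause's author must produce at every record; nothing of it is claimed here. [folklore] -/
theorem s_N14_record₁₁_of_slotClause
    (hΦ : ∀ (F : T4Family) (D : Datum F N) (g₀ : ℕ → ℝ) (os : List (ULoop F)) (R : RateCarriers N),
      (∃ w : DagBinding.WorldP, Node00.IsRecordOfRecord₁₁C F N D w) → Φ F D g₀ os R →
        ∃ U : UniformConstants, U.Λ = R.ne1.Λ ∧ ∀ p K, Nonempty (BookingLeaves U (R.ne1.𝒯.B p K) (R.ne1.𝒯.T p K))) :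
    S_N14 (fun F D g₀ os R => (∃ w : DagBinding.WorldP, Node00.IsRecordOfRecord₁₁C F N D w) ∧ Φ F D g₀ os R) :=
  s_N14_of_uniformLeaves _ fun F D g₀ os R hR => hΦ F D g₀ os R hR.1 hR.2

/-- **EVERY REFINEMENT OF THE SLOT-KEYED STAGE-11 HOME CLOSES** [bookkeeping]: ONE application of n14-a's `s_N14_of_refines` — the shape a later-stage
home (₁₂, …) keyed on MORE than the slot inherits. [folklore] -/
theorem s_N14_of_refines_record₁₁_slot (RRec : RateRecordPred N)
    (href : ∀ (F : T4Family) (D : Datum F N) (g₀ : ℕ → ℝ) (os : List (ULoop F)) (R : RateCarriers N), RRec F D g₀ os R →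
      (∃ w : DagBinding.WorldP, Node00.IsRecordOfRecord₁₁C F N D w) ∧
        ∃ U : UniformConstants, U.Λ = R.ne1.Λ ∧ ∀ p K, Nonempty (BookingLeaves U (R.ne1.𝒯.B p K) (R.ne1.𝒯.T p K))) :
    S_N14 RRec :=
  s_N14_of_refines
    (fun F D _ _ R => (∃ w : DagBinding.WorldP, Node00.IsRecordOfRecord₁₁C F N D w) ∧
      ∃ U : UniformConstants, U.Λ = R.ne1.Λ ∧ ∀ p K, Nonempty (BookingLeaves U (R.ne1.𝒯.B p K) (R.ne1.𝒯.T p K)))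
    RRec (fun _ _ _ _ _ h => h.2) href

end Homes

/-- **THE JUNK TEST — AT THE SLOT-KEYED STAGE-11 HOME BOTH K4's EXISTENCE STUB `S_R00x` AND `S_N14` CLOSE BY THE TOY BUNDLE** [decided toy]: with
`Rec₁₁ := IsRecordOfRecord₁₁C` and `RRec := «∃ w, IsRecordOfRecord₁₁C F N D w» ∧ «slot at R.ne1»`, the existence stub holds for trivial thresholds
(`ForSmallCouplings.of_forall`) by the bundle whose `ne1` is the owner's toy tower `⟨Unit, toyTower, 2⟩` (`uniformLeaves_inhabited`) with degenerate
sibling carriers, and `S_N14` holds by `s_N14_record₁₁_of_slotClause`.  The pair therefore carries NO content about Bałaban's run: a clause about `R.ne1`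
ALONE never pins the dressed tower OF RECORD.  R422 for K4's N14, in the kernel. [folklore] -/
theorem slotKey₁₁_closes_R00x_and_N14 :
    S_R00x (fun F D w => Node00.IsRecordOfRecord₁₁C F N D w)
        (fun F D _ _ R => (∃ w : DagBinding.WorldP, Node00.IsRecordOfRecord₁₁C F N D w) ∧
          ∃ U : UniformConstants, U.Λ = R.ne1.Λ ∧ ∀ p K, Nonempty (BookingLeaves U (R.ne1.𝒯.B p K) (R.ne1.𝒯.T p K))) ∧
      S_N14 (fun F D _ _ R => (∃ w : DagBinding.WorldP, Node00.IsRecordOfRecord₁₁C F N D w) ∧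
          ∃ U : UniformConstants, U.Λ = R.ne1.Λ ∧ ∀ p K, Nonempty (BookingLeaves U (R.ne1.𝒯.B p K) (R.ne1.𝒯.T p K))) := by
  refine ⟨?_, s_N14_record₁₁_of_slotClause _ fun _ _ _ _ _ _ h => h⟩
  intro F D w hR _ _
  refine T4ContinuumYM4Torus.ForSmallCouplings.of_forall fun _ _ => ?_
  -- the toy bundle: the owner's toy tower at its count rate `2`, degenerate sibling carriers
  let R₀ : RateCarriers N :=
    { ne1 := ⟨Unit, toyTower, 2⟩
      ne2 := { I := PEmpty, c35 := 0, p := 0, pi := fun i => i.elim, Kop := fun i => i.elim, Ksite := fun i => i.elim,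
               Kunit := fun i => i.elim, inΛ := fun i => i.elim, unitDist := fun i => i.elim }
      ne3 := ⟨1, 1, 1, 0, 0, 0, 0, 0, ∅⟩
      u3 := { C := ⟨Unit, fun _ => 1, fun _ => 0, fun _ => le_rfl, Unit, Unit, fun _ _ => 0, fun _ _ => le_rfl, id⟩,
              W := ∅, γ := 0, κ := 0, EA := fun _ _ _ => 0, EB := fun _ _ _ _ => 0, θ := 0, C₅ := 0,
              Λ := fun _ _ => 0, C₉ := 0, ω := 0, cr := 0, ρ := 0 } }
  exact ⟨R₀, ⟨w, hR⟩, uniformLeaves_inhabited⟩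

/-- The same junk closes the TAUTOLOGICAL home «record key ∧ N14At R.ne1» end to end (existence by the toy bundle, `n14At_toyTower`; the stub by
projection) — listing it so that no later filing mistakes either home for progress on N14. [folklore] -/
theorem n14Key₁₁_closes_R00x_and_N14 :
    S_R00x (fun F D w => Node00.IsRecordOfRecord₁₁C F N D w)
        (fun F D _ _ R => (∃ w : DagBinding.WorldP, Node00.IsRecordOfRecord₁₁C F N D w) ∧ N14At R.ne1) ∧
      S_N14 (fun F D _ _ R => (∃ w : DagBinding.WorldP, Node00.IsRecordOfRecord₁₁C F N D w) ∧ N14At R.ne1) := by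
  refine ⟨?_, fun _ _ _ _ _ h => h.2⟩
  intro F D w hR _ _
  refine T4ContinuumYM4Torus.ForSmallCouplings.of_forall fun _ _ => ?_
  let R₀ : RateCarriers N :=
    { ne1 := ⟨Unit, toyTower, 2⟩
      ne2 := { I := PEmpty, c35 := 0, p := 0, pi := fun i => i.elim, Kop := fun i => i.elim, Ksite := fun i => i.elim,
               Kunit := fun i => i.elim, inΛ := fun i => i.elim, unitDist := fun i => i.elim }
      ne3 := ⟨1, 1, 1, 0, 0, 0, 0, 0, ∅⟩
      u3 := { C := ⟨Unit, fun _ => 1, fun _ => 0, fun _ => le_rfl, Unit, Unit, fun _ _ => 0, fun _ _ => le_rfl, id⟩,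
              W := ∅, γ := 0, κ := 0, EA := fun _ _ _ => 0, EB := fun _ _ _ _ => 0, θ := 0, C₅ := 0,
              Λ := fun _ _ => 0, C₉ := 0, ω := 0, cr := 0, ρ := 0 } }
  exact ⟨R₀, ⟨w, hR⟩, n14At_toyTower⟩

/-- **THE OBJECT-KEYED SHAPE — WHAT A CONTENT-BEARING HOME MAKES OF THE STUB** [bookkeeping]: if `RRec` PINS the NE1′ carriers to an object
`ne1Of F D g₀ os : NE1pCarriers` of the record data (the dressed tower OF RECORD and its rate — the definer's ∕ NODE O's term), then `S_N14 RRec` IS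
«NE1′ holds for that object at every admitted `(F, D, g₀, os)`» (`Iff`).  The dual of §1's test: such a home is NOT closed under swapping `R.ne1`, the junk
bundles of §§2–3 are not admitted, and the stub's content is exactly the s1 dressing estimate for the object. [folklore] -/
theorem s_N14_iff_of_pinned (RRec : RateRecordPred N)
    (ne1Of : ∀ F : T4Family, Datum F N → (ℕ → ℝ) → List (ULoop F) → NE1pCarriers)
    (hpin : ∀ (F : T4Family) (D : Datum F N) (g₀ : ℕ → ℝ) (os : List (ULoop F)) (R : RateCarriers N),
      RRec F D g₀ os R → R.ne1 = ne1Of F D g₀ os) :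
    S_N14 RRec ↔ ∀ (F : T4Family) (D : Datum F N) (g₀ : ℕ → ℝ) (os : List (ULoop F)),
      (∃ R : RateCarriers N, RRec F D g₀ os R) → N14At (ne1Of F D g₀ os) := by
  constructor
  · rintro h F D g₀ os ⟨R, hR⟩
    rw [← hpin F D g₀ os R hR]
    exact h F D g₀ os R hR
  · intro h F D g₀ os R hR
    rw [hpin F D g₀ os R hR]
    exact h F D g₀ os ⟨R, hR⟩

/-! ## §4 The sibling rates do not give NE1′ at the carriers (FAN-OUT v1.1 §N14 s3 verdict) -/

omit [NeZero N] in
/-- **A RATE-CARRIER BUNDLE WITH N15, N16, N18, N22 AT ITS CARRIERS AND WITHOUT N14** [decided toy]: DEGENERATE sibling carriers (no paired instance, empty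
admissible unit-lattice data, empty coupling window, zero history moduli) satisfy `N15At` ∕ `N16At` ∕ `N18At` ∕ `N22At` by vacuity ∕ `0 ≤ 0`, while `ne1` is
the doubling tower at its count rate (`not_n14At_growing_one`).  The sub-bundles of `RateCarriers` are independent coordinates. [folklore] -/
theorem exists_siblings_not_n14At :
    ∃ R : RateCarriers N, N15At R.ne2 ∧ N16At R.ne3 ∧ N18At R.u3 ∧ N22At R.u3 ∧ ¬ N14At R.ne1 := by
  let R₀ : RateCarriers N :=
    { ne1 := ⟨Unit, growingTower, 1⟩
      ne2 := { I := PEmpty, c35 := 0, p := 0, pi := fun i => i.elim, Kop := fun i => i.elim, Ksite := fun i => i.elim,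
               Kunit := fun i => i.elim, inΛ := fun i => i.elim, unitDist := fun i => i.elim }
      ne3 := ⟨1, 1, 1, 0, 0, 0, 0, 0, ∅⟩
      u3 := { C := ⟨Unit, fun _ => 1, fun _ => 0, fun _ => le_rfl, Unit, Unit, fun _ _ => 0, fun _ _ => le_rfl, id⟩,
              W := ∅, γ := 0, κ := 0, EA := fun _ _ _ => 0, EB := fun _ _ _ _ => 0, θ := 0, C₅ := 0,
              Λ := fun _ _ => 0, C₉ := 0, ω := 0, cr := 0, ρ := 0 } }
  refine ⟨R₀, ?_, ?_, ?_, ?_, not_n14At_growing_one⟩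
  · -- N15: the three NE2⁺ layers over the EMPTY index type (positive constants, vacuous `∀ i : PEmpty`)
    refine ⟨⟨1, 1, 1, 1, 1, one_pos, one_pos, one_pos, one_pos, one_pos, fun i => i.elim⟩,
      ⟨1, 1, 1, 1, 1, one_pos, one_pos, one_pos, one_pos, one_pos, fun i => i.elim⟩,
      ⟨1, 1, 1, 1 / 2, one_pos, one_pos, one_pos, by norm_num, by norm_num, fun i => i.elim⟩⟩
  · -- N16: `NE3EnergyRateWCov … dom` over the EMPTY admissible data
    intro k _ V hV
    exact absurd hV (Set.notMem_empty V)
  · -- N18: `∀ b, 0 < b → b ≤ γ → NE5 …` with the EMPTY coupling window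
    intro b _ _ g hg
    exact absurd hg (Set.notMem_empty g)
  · -- N22: `NE9` over the EMPTY window and `FadingMemory 0 0 0`
    refine ⟨fun g hg => absurd hg (Set.notMem_empty g), fun k i _ => ?_⟩
    simp [R₀]

omit [NeZero N] in
/-- **NO CARRIER-LEVEL ARROW «SIBLINGS ⇒ NE1′»** [bookkeeping]: the implication `N15At R.ne2 → N16At R.ne3 → N18At R.u3 → N22At R.u3 → N14At R.ne1` FAILS
for some bundle; FAN-OUT §N14 s3's «NE5 ∧ NE3 ∧ tilted-analyticity ⇒ NE1′ as one theorem at the spine carriers» is not typable without a LINK datum and a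
single-run dressed size estimate — «none honest» today. [folklore] -/
theorem not_n14At_of_siblings :
    ¬ ∀ R : RateCarriers N, N15At R.ne2 → N16At R.ne3 → N18At R.u3 → N22At R.u3 → N14At R.ne1 := by
  intro h
  obtain ⟨R, h15, h16, h18, h22, hn⟩ := exists_siblings_not_n14At (N := N)
  exact hn (h R h15 h16 h18 h22)

/-! ## §5 (v1.1) THE θ-KEYED STAGE-PATTERN HOME «`R = rc θ hP ℓ g₀ os`» — N14's faces for ANY carrier map of record, so the knit is ONE `exact`
(the home in flight at `node00-def-RR-1∕-RR-2`, PRE-READ-RR-2 §B: `RRec₁₁ F D g₀ os R :↔ ∃ θ hP ℓ, θ.Admissible ∧ D = datumOfRecord₁₁ F N θ hP ∧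
R = rateCarriersOfRecord₁₁ F N θ hP ℓ g₀ os`; the bundle is a function of `θ`, which `D` does not determine, so the function-keyed `s_N14_iff_of_pinned`
does not apply verbatim — RR-2's TRAP; here everything is GENERIC in the carrier map `rc` and the binder type `Λ'`) -/

section ThetaKeyed

variable {Λ' : ∀ F : T4Family, Node00.Stage11Params F N → Type*}
variable (rc : ∀ (F : T4Family) (θ : Node00.Stage11Params F N), θ.Provisos₁₁ → Λ' F θ → (ℕ → ℝ) → List (ULoop F) → RateCarriers N)

/-- **THE PARAMETER-KEYED FACE, for ANY carrier description `Pc`** (`Iff`): at the home «∃ θ hP, θ.Admissible ∧ D = datumOfRecord₁₁ θ hP ∧ Pc θ hP g₀ os R»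
(functional key: `Pc … R := R = rc θ hP g₀ os`; with a binder: `Pc … R := ∃ ℓ, R = rc θ hP ℓ g₀ os`) the stub reads «N14 at every bundle the description
admits, at every admissible parameter» — whichever key (T-RATE) lands, ONE `exact`. [folklore] -/
theorem s_N14_paramKey_iff
    (Pc : ∀ (F : T4Family) (θ : Node00.Stage11Params F N), θ.Provisos₁₁ → (ℕ → ℝ) → List (ULoop F) → RateCarriers N → Prop) :
    S_N14 (fun F D g₀ os R => ∃ (θ : Node00.Stage11Params F N) (hP : θ.Provisos₁₁), θ.Admissible ∧ D = Node00.datumOfRecord₁₁ F N θ hP ∧ Pc F θ hP g₀ os R) ↔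
      ∀ (F : T4Family) (θ : Node00.Stage11Params F N) (hP : θ.Provisos₁₁), θ.Admissible →
        ∀ (g₀ : ℕ → ℝ) (os : List (ULoop F)) (R : RateCarriers N), Pc F θ hP g₀ os R → N14At R.ne1 :=
  ⟨fun h F θ hP hθ g₀ os R hR => h F _ g₀ os R ⟨θ, hP, hθ, rfl, hR⟩,
    fun h F _ g₀ os R ⟨θ, hP, hθ, _, hR⟩ => h F θ hP hθ g₀ os R hR⟩

/-- **WHAT `S_N14` SAYS AT A θ-KEYED HOME WITH BINDER** (`Iff`): NE1′ at `(rc F θ hP ℓ g₀ os).ne1` for every admissible parameter, binder, sequence,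
string — the stub IS the dressing estimate for that OBJECT (junk iff `rc`'s `ne1` ignores `θ`, e.g. a constant toy tower: `n14At_toyTower`). [folklore] -/
theorem s_N14_thetaKey_iff :
    S_N14 (fun F D g₀ os R => ∃ (θ : Node00.Stage11Params F N) (hP : θ.Provisos₁₁) (ℓ : Λ' F θ),
        θ.Admissible ∧ D = Node00.datumOfRecord₁₁ F N θ hP ∧ R = rc F θ hP ℓ g₀ os) ↔
      ∀ (F : T4Family) (θ : Node00.Stage11Params F N) (hP : θ.Provisos₁₁) (ℓ : Λ' F θ), θ.Admissible →
        ∀ (g₀ : ℕ → ℝ) (os : List (ULoop F)), N14At (rc F θ hP ℓ g₀ os).ne1 :=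
  ⟨fun h F θ hP ℓ hθ g₀ os => h F _ g₀ os _ ⟨θ, hP, ℓ, hθ, rfl, rfl⟩,
    fun h F _ g₀ os _ ⟨θ, hP, ℓ, hθ, _, hR⟩ => hR ▸ h F θ hP ℓ hθ g₀ os⟩

/-- **THE KNIT AT A θ-KEYED HOME** [bookkeeping]: the dressing estimate for the object of record (n14-c's s1, currency `N14At`) gives `S_N14`. [folklore] -/
theorem s_N14_thetaKey_of_n14At
    (h : ∀ (F : T4Family) (θ : Node00.Stage11Params F N) (hP : θ.Provisos₁₁) (ℓ : Λ' F θ), θ.Admissible →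
      ∀ (g₀ : ℕ → ℝ) (os : List (ULoop F)), N14At (rc F θ hP ℓ g₀ os).ne1) :
    S_N14 (fun F D g₀ os R => ∃ (θ : Node00.Stage11Params F N) (hP : θ.Provisos₁₁) (ℓ : Λ' F θ),
        θ.Admissible ∧ D = Node00.datumOfRecord₁₁ F N θ hP ∧ R = rc F θ hP ℓ g₀ os) :=
  (s_N14_thetaKey_iff rc).2 h

/-- … or from the SLOT at the object: uniform leaves at its own rate (END-B via `n14At_of_uniformLeaves`) give `S_N14`. [folklore] -/
theorem s_N14_thetaKey_of_uniformLeaves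
    (h : ∀ (F : T4Family) (θ : Node00.Stage11Params F N) (hP : θ.Provisos₁₁) (ℓ : Λ' F θ), θ.Admissible →
      ∀ (g₀ : ℕ → ℝ) (os : List (ULoop F)), ∃ U : UniformConstants, U.Λ = (rc F θ hP ℓ g₀ os).ne1.Λ ∧
        ∀ p K, Nonempty (BookingLeaves U ((rc F θ hP ℓ g₀ os).ne1.𝒯.B p K) ((rc F θ hP ℓ g₀ os).ne1.𝒯.T p K))) :
    S_N14 (fun F D g₀ os R => ∃ (θ : Node00.Stage11Params F N) (hP : θ.Provisos₁₁) (ℓ : Λ' F θ),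
        θ.Admissible ∧ D = Node00.datumOfRecord₁₁ F N θ hP ∧ R = rc F θ hP ℓ g₀ os) :=
  s_N14_thetaKey_of_n14At rc fun F θ hP ℓ hθ g₀ os => n14At_of_uniformLeaves _ (h F θ hP ℓ hθ g₀ os)

/-- **K4's EXISTENCE STUB CLOSES BY THE HOME ITSELF, FOR ANY CARRIER MAP with inhabited binders** (`exists_provisos_of_isRecordOfRecord₁₁C` +
`ForSmallCouplings.of_forall`; RR-2 §B generic) — so NOTHING of N14 sits in `S_R00x`: ALL of it is `∀ θ …, N14At (rc …).ne1`, real or junk as `rc` is. [folklore] -/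
theorem s_R00x_thetaKey (hℓ : ∀ (F : T4Family) (θ : Node00.Stage11Params F N), θ.Provisos₁₁ → θ.Admissible → Nonempty (Λ' F θ)) :
    S_R00x (fun F D w => Node00.IsRecordOfRecord₁₁C F N D w)
      (fun F D g₀ os R => ∃ (θ : Node00.Stage11Params F N) (hP : θ.Provisos₁₁) (ℓ : Λ' F θ),
        θ.Admissible ∧ D = Node00.datumOfRecord₁₁ F N θ hP ∧ R = rc F θ hP ℓ g₀ os) := by
  intro F D w hR _ _
  obtain ⟨θ, hP, hθ, hD⟩ := Node00.exists_provisos_of_isRecordOfRecord₁₁C hR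
  obtain ⟨ℓ⟩ := hℓ F θ hP hθ
  exact T4ContinuumYM4Torus.ForSmallCouplings.of_forall fun g₀ os => ⟨rc F θ hP ℓ g₀ os, θ, hP, ℓ, hθ, hD, rfl⟩

/-- **THE §1 TEST AT A θ-KEYED HOME**: if `rc`'s `ne1` TAKES THE VALUE `⟨Unit, growingTower, 1⟩` at some admissible parameter (e.g. a FREE binder `ℓ` over
`NE1pCarriers` with `(rc … ℓ …).ne1 = ℓ` — the residual-parameter design — once the class is inhabited), `S_N14` is FALSE. [folklore] -/
theorem not_s_N14_thetaKey_of_hits_growing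
    (hex : ∃ (F : T4Family) (θ : Node00.Stage11Params F N) (hP : θ.Provisos₁₁) (ℓ : Λ' F θ) (g₀ : ℕ → ℝ) (os : List (ULoop F)),
      θ.Admissible ∧ (rc F θ hP ℓ g₀ os).ne1 = ⟨Unit, growingTower, 1⟩) :
    ¬ S_N14 (fun F D g₀ os R => ∃ (θ : Node00.Stage11Params F N) (hP : θ.Provisos₁₁) (ℓ : Λ' F θ),
        θ.Admissible ∧ D = Node00.datumOfRecord₁₁ F N θ hP ∧ R = rc F θ hP ℓ g₀ os) := by
  rw [s_N14_thetaKey_iff]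
  obtain ⟨F, θ, hP, ℓ, g₀, os, hθ, hne1⟩ := hex
  exact fun h => not_n14At_growing_one (hne1 ▸ h F θ hP ℓ hθ g₀ os)

/-- **N14's FINAL-SCALE PROFILE AT THE OBJECT OF RECORD**: letter `ρ·Λ < 1` and `size b K ≤ A₀ρ^{K−j}` (n14-a `finalProfile_of_n14`) — what N19 reads. [folklore] -/
theorem finalProfile_at_thetaKey
    (h : S_N14 (fun F D g₀ os R => ∃ (θ : Node00.Stage11Params F N) (hP : θ.Provisos₁₁) (ℓ : Λ' F θ),
        θ.Admissible ∧ D = Node00.datumOfRecord₁₁ F N θ hP ∧ R = rc F θ hP ℓ g₀ os))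
    {F : T4Family} (θ : Node00.Stage11Params F N) (hP : θ.Provisos₁₁) (ℓ : Λ' F θ) (hθ : θ.Admissible) (g₀ : ℕ → ℝ) (os : List (ULoop F)) :
    ∃ A₀ ρ : ℝ, 0 ≤ A₀ ∧ 0 ≤ ρ ∧ 0 ≤ (rc F θ hP ℓ g₀ os).ne1.Λ ∧ ρ * (rc F θ hP ℓ g₀ os).ne1.Λ < 1 ∧
      ∀ (p : (rc F θ hP ℓ g₀ os).ne1.P) (K : ℕ) (b : ((rc F θ hP ℓ g₀ os).ne1.𝒯.B p K).Birth),
        ((rc F θ hP ℓ g₀ os).ne1.𝒯.B p K).size b K ≤ A₀ * ρ ^ (K - ((rc F θ hP ℓ g₀ os).ne1.𝒯.B p K).birthScale b) :=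
  finalProfile_of_n14 ((s_N14_thetaKey_iff rc).1 h F θ hP ℓ hθ g₀ os)

end ThetaKeyed

end YMDAG.N14

end
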